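import Summits.CriticalPhenomena.PercolationContinuityZ3.Theorems.PercNearOneGluingNoHeavyLowerTailMixCSHUnfoldTools
import HarnessLib

/-!
# `NoHeavyLowerTail` (stmt-CriticalPhenomena-4575) — MIXED conditioned slack hierarchy (hub observer), Lemma U for general `k`:
# the world term of ONE decoy in the HUB ROW (Markov at `C_Y`, dead decoys drop out, Markov at `C_d` with the REMAINDER `R_j`, centring)

Support file (`--supports stmt-CriticalPhenomena-4575`), prover `prim-hp-7` (gen 33); part (b) of brick B2 (`MixCSHUnfold`) of prim-ineq-gen-7's Lean
blueprint for THEOREM M1 (memo `prim-ineq-gen-7/PROOF-Q9-MIXED-CSH.md` §3.2–3.3 / §10, write-up `Q9-WRITEUP.md` Lemma 6.3 Steps 2–3).  No named facts,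
no sorries.  Sum level (`BHK2006.weight`, `Σ weight = 1`), worlds = delete the pairs meeting `Y ∪ V(C_Y(ω))` (`HullPort.cut Y ω`), in the vocabulary of
prim-hp-8 / prim-ineq-prove-1's pure Lemma U (`CSH.wcovOff`, `CSH.wmeanOff`, `CSH.resid`, `CSH.phiS`, `CSH.decoy_world_term` of `…CSHUnfoldDecoy.lean`)
and of the hub-row level-form algebra `MixCSH.mixChi / mixUnfoldT` (`…MixCSHLevelForms.lean`).

THE HUB ROW.  Owner `x`, avoided set `Y`, source set `S ∋ x` (owner + earlier decoys), decoy `d ∉ S`, later decoys `L'` (none equal to `d` or to the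
hub label `o`), hub set `Σ`; in the world of `ω` (label `ω`, world configuration `β`) the hub predicate is
`Hc^ω_β(u) ⟺ 1{Σ ↮ Y}(ω) ∧ ∃ σ ∈ Σ, u ↔ σ [β]` (`MixCSH.hubPred`; the avoidance factor of the hub test is FROZEN in the world, memo §3.1), and the
`d`-term of the hub-row unfolding (`MixCSH.mixUnfoldT` at `u = o`) is `ε(d)·sl_{L'}[mixChi_{S,d} − c](o)` with the hub entry
`1{Hc d ∧ ∀ s ∈ S, ¬ Hc s}` (KEY SET IDENTITY).  THIS FILE proves (`MixCSH.hub_decoy_world_term`):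

  `Σ_ω w(ω) 1{x↮Y}(ω) · Cov_{world(ω)}( g(C_x), ε(d)·sl_{L'}[mixChi_{S,d} − c](o) )`
  `   =  −m₀⁻¹ · sl_{L'}[ w' ↦ m₀·P₁(w') − m₁(w')·P₀ ](o)  +  sl_{L'}[δ_o](o) · R'`,

`E = {d ↮ S ∪ Y}`, `m₀ = μ(E)`, and at a vertex `w'` the pure masses/moments `m₁(w') = μ(E ∩ {d↔w'})`, `P₁(w') = Σ w 1_E 1{d↔w'} Φ(C_d)`, while AT THE
HUB LABEL `o` they are those of the MIXED decoy test `hubEv Σ d (S ∪ Y) = {Σ ↔ d} ∩ {Σ ↮ S ∪ Y}` (`m₁(o) = μ(E ∩ hubEv)`, `P₁(o) = Σ w 1_{E∩hubEv} Φ(C_d)`),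
`P₀ = Σ w 1_E Φ(C_d)`, `c = m₁/m₀` (the mixed decoy constant), and THE REMAINDER

  `R' = Σ_ζ w(ζ) 1_E(ζ) 1{Σ ↔ d}(ζ) · Cov_{off C_d(ζ)}( Θ, 1{Σ ↮ S ∪ Y} )`      (`MixCSH.hubRem`; = `μ(E)·R_j` of the memo),

`Θ` the telescoping residual `CSH.resid` (the world mean inside it is taken in the FULL graph), the covariance in the fresh configuration off the
pairs meeting `C_d(ζ)` (`CSH.wcovOff w {d}`).  The memo's Lemma R⁻ (brick B3) asserts `R' ≤ 0`; here `R'` is only isolated.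
Steps (tools in `…MixCSHUnfoldTools.lean`): Markov merge at `C_Y` for a world test depending on the label through `C_Y` (`markov_merge_Y₂`); alive decoy ⇒ the world hub test is the GLOBAL
mixed test `hubEv Σ d (S ∪ Y)` (`world_hub_term_alive`), dead decoy ⇒ the hub entry vanishes (the hub avoids `U_Y ∋ d`) and the term is configuration-free
(`world_hub_term_dead`) and dies against the residual; linearity of `sl_{L'}`; for the vertex entries prim-ineq-prove-1's centred moments
(`CSH.sum_resid_decoy_moment`), for the hub entry Markov at `C_d` applied to the product `1{Σ↔d}(C_d)·1{Σ↮S∪Y}(off C_d)` (`sum_resid_hub_moment`):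
the second factor is NOT a function of `C_d`, whence the covariance remainder `R'`.
[cite: VandenbergHaggstromKahn2005, §2.1 Lemma 2.4 (p. 10); §1 display (10) (pp. 7–8) — corollaries] [cite: KozmaNitzan2024, Question 9 (§5.5 p. 36)]
-/


noncomputable section

namespace Summit.CriticalPhenomena.PercolationContinuityZ3.Theorems

open MeasureTheory Set Literature.Probability.LatticeModels Literature.Probability.Percolation
open scoped Classical
open BHK2006 DecisionTree HullPort CSH

namespace MixCSH

variable {V : Type*} [Fintype V]

/-! ### The centred hub moment -/

/-- **The centred hub moment** (memo §3.2 Step 3: `E_{ρ_j}[Θ·(ω^{(j)}_o − c_j(o))] = R_j − Cov_{ρ_j}(Φ(C_{d_j}), ω^{(j)}_o)`, denominator-free):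
with `E = {d ↮ A}` (`A ⊇ {x} ∪ Y`), `m₀ = μ(E) ≠ 0`, `m₁ = μ(E ∩ hubSet)`, `c = m₁/m₀`, `P₁ = Σ w 1_{E∩hubSet} Φ(C_d)`, `P₀ = Σ w 1_E Φ(C_d)`:
`Σ_ζ w Θ·1_E·(1_{hubSet} − c) = R' − m₀⁻¹·(m₀ P₁ − m₁ P₀)`.  The product `1_{hubSet} = 1{Σ↔d}(C_d)·1{Σ↮A}` has a factor which is NOT a function of
`C_d`; Markov at `C_d` + Lemma Φ(a) (`CSH.sum_resid_world_singleton`) produce the covariance remainder `R'`.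
(transcription of the cell memo prim-ineq-gen-7 PROOF-Q9-MIXED-CSH.md §3.2 Step 3) [cite: VandenbergHaggstromKahn2005, §2.1 Lemma 2.4 (p. 10) — corollary] -/
theorem sum_resid_hub_moment (w : Sym2 V → ℝ) (hm : ∑ ω, weight w ω = 1) (x : V) (Y : Set V)
    (g : Set (Sym2 V) → ℝ) (Sig : Set V) (d : V) {A : Set V} (hA : insert x Y ⊆ A) {c : ℝ}
    (hm₀ : ∑ ζ, weight w ζ * ind (avoidEv d A) ζ ≠ 0)
    (hc : c = (∑ ζ, weight w ζ * ind (avoidEv d A ∩ hubSet Sig d A) ζ) / ∑ ζ, weight w ζ * ind (avoidEv d A) ζ) :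
    ∑ ζ, weight w ζ * (resid w x Y g ζ * (ind (avoidEv d A) ζ * (ind (hubSet Sig d A) ζ - c))) =
      hubRem w x Y g Sig d A -
        (∑ ζ, weight w ζ * ind (avoidEv d A) ζ)⁻¹ *
          ((∑ ζ, weight w ζ * ind (avoidEv d A) ζ) *
              (∑ ζ, weight w ζ * (ind (avoidEv d A ∩ hubSet Sig d A) ζ * phiS w x Y g d ζ)) -
            (∑ ζ, weight w ζ * ind (avoidEv d A ∩ hubSet Sig d A) ζ) *
              (∑ ζ, weight w ζ * (ind (avoidEv d A) ζ * phiS w x Y g d ζ))) := by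
  classical
  -- the touch indicator as a function of the edge cluster of `d`
  set a : Set (Sym2 V) → ℝ := fun K => if (∃ z ∈ Sig, z = d ∨ ∃ e ∈ K, z ∈ e) then (1 : ℝ) else 0 with ha
  have haK : ∀ ζ : Set (Sym2 V), a (openEdgeCluster ζ d) = ind (hubTouch Sig d) ζ := fun ζ => by
    rw [ha, ind_hubTouch_eq_ite_cluster]
  -- `Φ(C_d)` as a function of the edge cluster of `d`
  set φK : Set (Sym2 V) → ℝ := fun K => ∑ η, weight w η * phiIntegrand x Y (insert d {u | ∃ e ∈ K, u ∈ e}) g η with hφK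
  have hφ : ∀ ζ : Set (Sym2 V), φK (openEdgeCluster ζ d) = phiS w x Y g d ζ := fun ζ => by
    simp only [hφK, phiS, ← openCluster_eq_insert_span]
  have hq : ∀ ζ, ζ ∈ avoidEv d A → hubAvoidInd Sig A (ζ \ cut {d} ζ) = hubAvoidInd Sig A ζ :=
    fun ζ h => hubAvoidInd_sdiff_cut_singleton Sig A h
  set m₀ := ∑ ζ, weight w ζ * ind (avoidEv d A) ζ with hm₀'
  set m₁ := ∑ ζ, weight w ζ * ind (avoidEv d A ∩ hubSet Sig d A) ζ with hm₁'
  set P₁ := ∑ ζ, weight w ζ * (ind (avoidEv d A ∩ hubSet Sig d A) ζ * phiS w x Y g d ζ) with hP₁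
  set P₀ := ∑ ζ, weight w ζ * (ind (avoidEv d A) ζ * phiS w x Y g d ζ) with hP₀
  -- (1) the constant part: `Σ w Θ 1_E c = −c P₀` (Markov at `C_d` + Lemma Φ(a), test function `1`)
  have h1 : ∑ ζ, weight w ζ * (resid w x Y g ζ * (ind (avoidEv d A) ζ * c)) = - (c * P₀) := by
    have h := sum_resid_mul_clusterFn w hm x Y g d hA (fun _ => c)
    have e1 : ∑ ζ, weight w ζ * (resid w x Y g ζ * (ind (avoidEv d A) ζ * (fun _ : Set (Sym2 V) => c) (openEdgeCluster ζ d))) =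
        ∑ ζ, weight w ζ * (resid w x Y g ζ * (ind (avoidEv d A) ζ * c)) := rfl
    rw [e1] at h
    rw [h, hP₀, Finset.mul_sum, ← Finset.sum_neg_distrib, ← Finset.sum_neg_distrib]
    exact Finset.sum_congr rfl fun ζ _ => by ring
  -- (2) the hub part: Markov at `C_d` for the product `1{Σ↔d}(C_d) · (Θ · 1{Σ↮A})`
  have h2 : ∑ ζ, weight w ζ * (resid w x Y g ζ * (ind (avoidEv d A) ζ * ind (hubSet Sig d A) ζ)) =
      hubRem w x Y g Sig d A - ∑ ζ, weight w ζ * (ind (avoidEv d A) ζ * ind (hubTouch Sig d) ζ *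
        (phiS w x Y g d ζ * wmeanOff w {d} (hubAvoidInd Sig A) ζ)) := by
    have e1 : ∑ ζ, weight w ζ * (resid w x Y g ζ * (ind (avoidEv d A) ζ * ind (hubSet Sig d A) ζ)) =
        ∑ ζ, weight w ζ * (ind (avoidEv d A) ζ * a (openEdgeCluster ζ d) * (resid w x Y g ζ * hubAvoidInd Sig A ζ)) :=
      Finset.sum_congr rfl fun ζ _ => by rw [ind_hubSet_eq, haK]; ring
    rw [e1, sum_resid_clusterFn_offFn w hm x Y g d hA a (hubAvoidInd Sig A) hq, hubRem, ← Finset.sum_sub_distrib]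
    refine Finset.sum_congr rfl fun ζ _ => ?_
    have hcov : wmeanOff w {d} (fun β => resid w x Y g β * hubAvoidInd Sig A β) ζ =
        wcovOff w {d} (resid w x Y g) (hubAvoidInd Sig A) ζ +
          wmeanOff w {d} (resid w x Y g) ζ * wmeanOff w {d} (hubAvoidInd Sig A) ζ := by
      rw [wcovOff]; ring
    have hmean : wmeanOff w {d} (resid w x Y g) ζ = - phiS w x Y g d ζ := by
      rw [wmeanOff]; exact sum_resid_world_singleton w hm x Y g d ζ
    rw [hcov, hmean, haK]
    ring
  -- (3) `P₁` through the world mean of the avoidance factor (Markov at `C_d` for `1{Σ↔d}(C_d)·Φ(C_d) · 1{Σ↮A}`)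
  have h3 : P₁ = ∑ ζ, weight w ζ * (ind (avoidEv d A) ζ * ind (hubTouch Sig d) ζ *
      (phiS w x Y g d ζ * wmeanOff w {d} (hubAvoidInd Sig A) ζ)) := by
    have h := sum_clusterFn_offFn w hm d A (fun K => a K * φK K) (hubAvoidInd Sig A) hq
    have e1 : ∑ ζ, weight w ζ * (ind (avoidEv d A) ζ * (fun K => a K * φK K) (openEdgeCluster ζ d) * hubAvoidInd Sig A ζ) = P₁ := by
      rw [hP₁]
      refine Finset.sum_congr rfl fun ζ _ => ?_
      beta_reduce
      rw [haK, hφ, ind_inter, ind_hubSet_eq]; ring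
    rw [e1] at h
    rw [h]
    refine Finset.sum_congr rfl fun ζ _ => ?_
    rw [haK, hφ]; ring
  -- (4) `m₁` likewise (test function `1`)
  -- assemble
  have split : ∀ ζ, weight w ζ * (resid w x Y g ζ * (ind (avoidEv d A) ζ * (ind (hubSet Sig d A) ζ - c))) =
      weight w ζ * (resid w x Y g ζ * (ind (avoidEv d A) ζ * ind (hubSet Sig d A) ζ)) -
        weight w ζ * (resid w x Y g ζ * (ind (avoidEv d A) ζ * c)) := by
    intro ζ; ring
  rw [Finset.sum_congr rfl (fun ζ _ => split ζ), Finset.sum_sub_distrib, h1, h2, ← h3, hc]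
  field_simp
  ring

/-! ### The world term of one decoy in the hub row -/

/-- **THE WORLD TERM OF ONE DECOY IN THE HUB ROW** (memo §3.2, the `j`-th term of the mixed Lemma U at the hub label, before the `o − p·v`
combination).  Data: owner `x`, avoided set `Y`, source set `S ∋ x`, decoy `d ∉ S`, hub label `o ≠ d`, later decoys `L'` (none equal to `d` or `o`),
hub set `Σ`, `E = {d ↮ S ∪ Y}`, `m₀ = μ(E) ≠ 0`, the MIXED constant `c` (`c(w') = μ(E ∩ {d↔w'})/m₀` at vertices, `c(o) = μ(E ∩ hubSet Σ d (S∪Y))/m₀`).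
Then `Σ_ω w 1{x↮Y}(ω) Cov_{world(ω)}(g(C_x), ε(d)·sl_{L'}[mixChi_{S,d} − c](o))`
`  = −m₀⁻¹ · sl_{L'}[w' ↦ m₀·P₁(w') − m₁(w')·P₀](o) + sl_{L'}[δ_o](o) · R'`,
with the mixed masses/moments (`hubSet` at `o`, `{d ↔ w'}` elsewhere) and the remainder `R' = MixCSH.hubRem`.
(transcription of the cell memo prim-ineq-gen-7 PROOF-Q9-MIXED-CSH.md §3.2 Steps 2–3)
[cite: VandenbergHaggstromKahn2005, §2.1 Lemma 2.4 (p. 10); §1 display (10) (pp. 7–8) — corollaries] -/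
theorem hub_decoy_world_term (w : Sym2 V → ℝ) (hm : ∑ ω, weight w ω = 1) (x : V) (Y : Set V) (g : Set (Sym2 V) → ℝ)
    (Sig : Set V) {S : Set V} (hxS : x ∈ S) {d : V} (hdS : d ∉ S) {o : V} (hod : o ≠ d)
    (L' : List (V × (V → ℝ))) (hL' : ∀ dc ∈ L', dc.1 ≠ d) (c : V → ℝ)
    (hm₀ : ∑ ζ, weight w ζ * ind (avoidEv d (S ∪ Y)) ζ ≠ 0)
    (hc : ∀ w', w' ≠ o → c w' = (∑ ζ, weight w ζ * ind (avoidEv d (S ∪ Y) ∩ openConn d w') ζ) /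
      ∑ ζ, weight w ζ * ind (avoidEv d (S ∪ Y)) ζ)
    (hco : c o = (∑ ζ, weight w ζ * ind (avoidEv d (S ∪ Y) ∩ hubSet Sig d (S ∪ Y)) ζ) /
      ∑ ζ, weight w ζ * ind (avoidEv d (S ∪ Y)) ζ) :
    ∑ ω, weight w ω * (ind (avoidEv x Y) ω *
        wcovOff w Y (fun β => g (openEdgeCluster β x))
          (fun β => av (openGraph β).Reachable S d *
            slForm L' (fun w' => mixChi (openGraph β).Reachable (hubPred Sig Y ω β) o S d w' - c w') o) ω) =
      - ((∑ ζ, weight w ζ * ind (avoidEv d (S ∪ Y)) ζ)⁻¹ *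
          slForm L' (fun w' =>
            (∑ ζ, weight w ζ * ind (avoidEv d (S ∪ Y)) ζ) *
                (∑ ζ, weight w ζ * (ind (avoidEv d (S ∪ Y) ∩
                  (if w' = o then hubSet Sig d (S ∪ Y) else (openConn d w' : Set (BondConfig V)))) ζ * phiS w x Y g d ζ)) -
              (∑ ζ, weight w ζ * ind (avoidEv d (S ∪ Y) ∩
                  (if w' = o then hubSet Sig d (S ∪ Y) else (openConn d w' : Set (BondConfig V)))) ζ) *
                (∑ ζ, weight w ζ * (ind (avoidEv d (S ∪ Y)) ζ * phiS w x Y g d ζ))) o) +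
        slForm L' (Pi.single o (1 : ℝ)) o * hubRem w x Y g Sig d (S ∪ Y) := by
  classical
  have hA : insert x Y ⊆ S ∪ Y := by
    intro a ha
    rcases mem_insert_iff.1 ha with rfl | ha
    · exact Or.inl hxS
    · exact Or.inr ha
  set G : Set (Sym2 V) → ℝ := fun β => g (openEdgeCluster β x) with hG
  -- the label-dependent world test function, through `C_Y`
  set ψ : Set (Sym2 V) → Set (Sym2 V) → ℝ := fun W β =>
    av (openGraph β).Reachable S d *
      slForm L' (fun w' => mixChi (openGraph β).Reachable
        (fun u => (∀ z ∈ Sig, ¬ (z ∈ Y ∨ ∃ e ∈ W, z ∈ e)) ∧ ∃ z ∈ Sig, (openGraph β).Reachable u z) o S d w' - c w') o with hψ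
  have hψω : ∀ ω β : Set (Sym2 V), ψ (setCl ω Y) β = av (openGraph β).Reachable S d *
      slForm L' (fun w' => mixChi (openGraph β).Reachable (hubPred Sig Y ω β) o S d w' - c w') o := by
    intro ω β
    have hiff : (∀ z ∈ Sig, ¬ (z ∈ Y ∨ ∃ e ∈ setCl ω Y, z ∈ e)) ↔ ∀ z ∈ Sig, ∀ y ∈ Y, ¬ (openGraph ω).Reachable y z := by
      refine forall₂_congr fun z _ => ?_
      rw [← setReach_iff ω Y z]
      exact ⟨fun h y hy hr => h ⟨y, hy, hr⟩, fun h ⟨y, hy, hr⟩ => h y hy hr⟩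
    have hpred : (fun u => (∀ z ∈ Sig, ¬ (z ∈ Y ∨ ∃ e ∈ setCl ω Y, z ∈ e)) ∧ ∃ z ∈ Sig, (openGraph β).Reachable u z) =
        hubPred Sig Y ω β := by
      funext u; simp only [hubPred, hiff]
    simp only [hψ, hpred]
  -- abbreviations for the right-hand side
  set m₀ := ∑ ζ, weight w ζ * ind (avoidEv d (S ∪ Y)) ζ with hm₀'
  set Tset : V → Set (Set (Sym2 V)) := fun w' =>
    if w' = o then hubSet Sig d (S ∪ Y) else (openConn d w' : Set (BondConfig V)) with hTset
  set Q : V → ℝ := fun w' =>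
    m₀ * (∑ ζ, weight w ζ * (ind (avoidEv d (S ∪ Y) ∩ Tset w') ζ * phiS w x Y g d ζ)) -
      (∑ ζ, weight w ζ * ind (avoidEv d (S ∪ Y) ∩ Tset w') ζ) *
        (∑ ζ, weight w ζ * (ind (avoidEv d (S ∪ Y)) ζ * phiS w x Y g d ζ)) with hQ
  -- Step 1: world covariance as a centred world mean, and the Markov merge at `C_Y` (label-dependent test)
  have step1 : ∑ ω, weight w ω * (ind (avoidEv x Y) ω * wcovOff w Y G (fun β => av (openGraph β).Reachable S d *
        slForm L' (fun w' => mixChi (openGraph β).Reachable (hubPred Sig Y ω β) o S d w' - c w') o) ω) =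
      ∑ ζ, weight w ζ * (resid w x Y g ζ * ψ (setCl ζ Y) (ζ \ cut Y ζ)) := by
    have h := markov_merge_Y₂ w hm x Y g ψ
    have lhs : ∀ ω, weight w ω * (ind (avoidEv x Y) ω * wcovOff w Y G (fun β => av (openGraph β).Reachable S d *
        slForm L' (fun w' => mixChi (openGraph β).Reachable (hubPred Sig Y ω β) o S d w' - c w') o) ω) =
        weight w ω * (ind (avoidEv x Y) ω * ∑ η, weight w η * ((g (openEdgeCluster (η \ cut Y ω) x) -
          wmeanOff w Y (fun β => g (openEdgeCluster β x)) ω) * ψ (setCl ω Y) (η \ cut Y ω))) := by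
      intro ω
      rw [wcovOff_eq_sum]
      congr 2
      refine Finset.sum_congr rfl fun η _ => ?_
      rw [hψω]
    rw [Finset.sum_congr rfl (fun ω _ => lhs ω), h]
    refine Finset.sum_congr rfl fun ζ _ => ?_
    unfold resid; ring
  -- Step 2: the world test in the merged configuration (alive / dead decoy)
  have step2 : ∀ ζ, ψ (setCl ζ Y) (ζ \ cut Y ζ) =
      ind (avoidEv d (S ∪ Y)) ζ * slForm L' (fun w' => ind (Tset w') ζ - c w') o +
        (1 - ind (avoidEv d Y) ζ) * (- slForm L' c o) := by
    intro ζ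
    rw [hψω ζ (ζ \ cut Y ζ)]
    by_cases h : ζ ∈ avoidEv d Y
    · rw [world_hub_term_alive h Sig S o L' c, ← ind_avoidEv_mul_union d S Y ζ, ind_of_mem h]
      have hf : (fun w' => (if w' = o then ind (hubSet Sig d (S ∪ Y)) ζ else ind (openConn d w' : Set (BondConfig V)) ζ) - c w') =
          fun w' => ind (Tset w') ζ - c w' := by
        funext w'
        simp only [hTset]
        split_ifs <;> rfl
      rw [hf]; ring
    · rw [world_hub_term_dead h Sig hdS hod L' hL' c, ind_of_not_mem h]
      have h0 : ind (avoidEv d (S ∪ Y)) ζ = 0 := ind_of_not_mem fun h' => h fun y hy => h' y (Or.inr hy)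
      rw [h0]; ring
  -- Step 3: the dead part dies against the residual
  have step3 : ∑ ζ, weight w ζ * (resid w x Y g ζ * ((1 - ind (avoidEv d Y) ζ) * (- slForm L' c o))) = 0 := by
    have h := residual_orthogonal w hm x Y g
      (fun W => (1 - (if (d ∈ Y ∨ ∃ e ∈ W, d ∈ e) then (0 : ℝ) else 1)) * (- slForm L' c o))
    rw [← h]
    refine Finset.sum_congr rfl fun ζ _ => ?_
    unfold resid
    rw [one_sub_ind_avoidEv_eq d Y ζ]; ring
  -- Step 4: the alive part, by linearity of `sl_{L'}` and the centred moments (pure at vertices, `sum_resid_hub_moment` at the hub)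
  have step4 : ∑ ζ, weight w ζ * (resid w x Y g ζ * (ind (avoidEv d (S ∪ Y)) ζ *
      slForm L' (fun w' => ind (Tset w') ζ - c w') o)) =
      - (m₀⁻¹ * slForm L' Q o) + slForm L' (Pi.single o (1 : ℝ)) o * hubRem w x Y g Sig d (S ∪ Y) := by
    have lin : ∀ ζ, slForm L' (fun w' => ind (Tset w') ζ - c w') o =
        ∑ w', slForm L' (Pi.single w' (1 : ℝ)) o * (ind (Tset w') ζ - c w') :=
      fun ζ => slForm_eq_sum_single L' _ o
    simp only [lin, Finset.mul_sum]
    rw [Finset.sum_comm]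
    have inner : ∀ w', ∑ ζ, weight w ζ * (resid w x Y g ζ * (ind (avoidEv d (S ∪ Y)) ζ *
        (slForm L' (Pi.single w' (1 : ℝ)) o * (ind (Tset w') ζ - c w')))) =
        slForm L' (Pi.single w' (1 : ℝ)) o * (- (m₀⁻¹ * Q w') + (if w' = o then hubRem w x Y g Sig d (S ∪ Y) else 0)) := by
      intro w'
      by_cases hw' : w' = o
      · rw [hw', if_pos rfl]
        have hT : Tset o = hubSet Sig d (S ∪ Y) := by simp only [hTset, if_pos rfl]
        have hQo : Q o = m₀ * (∑ ζ, weight w ζ * (ind (avoidEv d (S ∪ Y) ∩ hubSet Sig d (S ∪ Y)) ζ * phiS w x Y g d ζ)) -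
            (∑ ζ, weight w ζ * ind (avoidEv d (S ∪ Y) ∩ hubSet Sig d (S ∪ Y)) ζ) *
              (∑ ζ, weight w ζ * (ind (avoidEv d (S ∪ Y)) ζ * phiS w x Y g d ζ)) := by
          simp only [hQ, hT]
        have e2 : ∑ ζ, weight w ζ * (resid w x Y g ζ * (ind (avoidEv d (S ∪ Y)) ζ *
            (slForm L' (Pi.single o (1 : ℝ)) o * (ind (Tset o) ζ - c o)))) =
            slForm L' (Pi.single o (1 : ℝ)) o *
              ∑ ζ, weight w ζ * (resid w x Y g ζ * (ind (avoidEv d (S ∪ Y)) ζ * (ind (hubSet Sig d (S ∪ Y)) ζ - c o))) := by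
          rw [hT, Finset.mul_sum]; exact Finset.sum_congr rfl fun ζ _ => by ring
        rw [e2, sum_resid_hub_moment w hm x Y g Sig d hA hm₀ hco, hQo]
        ring
      · rw [if_neg hw', add_zero]
        have hT : Tset w' = (openConn d w' : Set (BondConfig V)) := by simp only [hTset, if_neg hw']
        have hQw : Q w' = m₀ * (∑ ζ, weight w ζ * (ind (avoidEv d (S ∪ Y) ∩ openConn d w') ζ * phiS w x Y g d ζ)) -
            (∑ ζ, weight w ζ * ind (avoidEv d (S ∪ Y) ∩ openConn d w') ζ) *
              (∑ ζ, weight w ζ * (ind (avoidEv d (S ∪ Y)) ζ * phiS w x Y g d ζ)) := by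
          simp only [hQ, hT]
        rw [hQw, hT, ← sum_resid_decoy_moment w hm x Y g d hA w' hm₀ (hc w' hw'), Finset.mul_sum]
        exact Finset.sum_congr rfl fun ζ _ => by ring
    rw [Finset.sum_congr rfl (fun w' _ => inner w'), slForm_eq_sum_single L' Q o, Finset.mul_sum, ← Finset.sum_neg_distrib]
    have e3 : ∀ w', slForm L' (Pi.single w' (1 : ℝ)) o * (- (m₀⁻¹ * Q w') + (if w' = o then hubRem w x Y g Sig d (S ∪ Y) else 0)) =
        - (m₀⁻¹ * (slForm L' (Pi.single w' (1 : ℝ)) o * Q w')) +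
          (if w' = o then slForm L' (Pi.single w' (1 : ℝ)) o * hubRem w x Y g Sig d (S ∪ Y) else 0) := by
      intro w'
      split_ifs <;> ring
    rw [Finset.sum_congr rfl (fun w' _ => e3 w'), Finset.sum_add_distrib, Finset.sum_ite_eq' Finset.univ o]
    simp only [Finset.mem_univ, if_true]
  -- assemble
  rw [step1]
  have split : ∀ ζ, weight w ζ * (resid w x Y g ζ * ψ (setCl ζ Y) (ζ \ cut Y ζ)) =
      weight w ζ * (resid w x Y g ζ * (ind (avoidEv d (S ∪ Y)) ζ *
        slForm L' (fun w' => ind (Tset w') ζ - c w') o)) +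
      weight w ζ * (resid w x Y g ζ * ((1 - ind (avoidEv d Y) ζ) * (- slForm L' c o))) := by
    intro ζ; rw [step2 ζ]; ring
  rw [Finset.sum_congr rfl (fun ζ _ => split ζ), Finset.sum_add_distrib, step3, step4, add_zero]

end MixCSH

end Summit.CriticalPhenomena.PercolationContinuityZ3.Theorems

end
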